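import Literature.AlgebraicGeometry.AbelianSchemes.AbelianSchemeLineBundleLiftOfSomeLift
import HarnessLib

/-!
# FLOOR-0 P1, sub-line F-11, grandchild line `F11LiftWithLineBundle` — STUB G2 CLOSED BY NAME: given ANY abelian lift, SOME abelian lift
# carries the Mumford bundle (MONO-G2)

Cell hodgecm-mathlib (D-0151), FLOOR 0, crux item HDel = stmt-HodgeConjecture-24835; grandchild line
`Cruxes/HDel/Lines/F11LiftWithLineBundle.lean` (v0.2P b985ff42542d2c98, F0P1b-plan (g0); parent `Cruxes/HDel/Lines/F11SmoothRoadA.lean`, stub α1-P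
`stub_liftWithLineBundle`), registered stub **G2 `stub_lineBundleLiftOfSomeLift`** (letter v0.2P :122–135, declsig e7db1ea7c18e4d6f).  PROOF lane,
Theorems-homed twin (T4 ∕ G0 convention: the closer lives under `Theorems/`, imports Literature∕Theorems only, never `Cruxes/…/Lines` — crux
workfiles are not built on the farm); filer F0P1c-p02 (g2) for the MONO-G2 integrator B-p13 (g22) (F0P1b-plan (g2) (R126)(d), B-p13 cut
2026-08-31T00:59:00Z).  This file proves the stub's TYPE restated BINDER FOR BINDER (token-identically to the body of
`Summit.HodgeConjecture.CorCM.Cruxes.HypDel.F11LiftWithLineBundle.stub_lineBundleLiftOfSomeLift`), so that the line's next edition closes the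
hole BY NAME: `theorem stub_lineBundleLiftOfSomeLift (g : ℕ) : … := F11StubG2LineBundleLift.stubG2_holds g`, and the END-GAME twin
`Theorems/F11SmoothRoadAStubF11` (B-p05 (g20)) calls `F11StubG2LineBundleLift.stubG2_holds g A k hk t ht0 htm hJ A₀ hA₀ D₀ pol₀ …` by name.

Content: NONE of its own — one line over ★ `Literature.AlgebraicGeometry.AbelianSchemes.AbelianSchemeOver.exists_lineBundleLift_of_lift`
(B-p13 (g22), `Literature/AlgebraicGeometry/AbelianSchemes/AbelianSchemeLineBundleLiftOfSomeLift.lean`: the MONO-G2 composition — pair-lift data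
from frames (LB-A, F0P1b-p07 (g0) ★ `…GlueLineBundleMovedLift`), the closed-fibre reading S-cf (★ `…GlueLineBundleClosedFibre`), the tangent
`1`-cocycle of a Čech `2`-cocycle on an abelian variety in characteristic `0` ((I1), F0P1b-p03∕p02 (g2) over the F-J3b cup-product surjectivity
`Ȟ¹ ⊗ Ȟ¹ ↠ Ȟ²`), the moved lift and its rank-one module (LB-B), base change ∕ abelian structure ∕ relative dimension of the moved lift
(★ `AbelianSchemeStructureOnLift`, `AbelianSchemeLiftRelDim`), rigidification for free over the Artinian local base (★ `CechPicOfLocalRing`)).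
The only textual delta to that head is `IsLocalRing.maximalIdeal` ↦ `maximalIdeal` under `open IsLocalRing` (same term).

HC_CM is proved only modulo the 7 printed citations until rung 0 closes; this closes ONE of the three stubs (G2; G0 ★ p792666, G1 = MONO-G1
`Theorems/F11StubG1AbelianLift`) of ONE grandchild line, and nothing here is about HC.

## References
* [MumfordFogartyKirwan1994] D. Mumford, J. Fogarty, F. Kirwan, *Geometric Invariant Theory*, 3rd ed. (1994): App. 7A (pp. 234–235) «the
  obstruction … can be killed by changing the lifting of `X`»; Ch. 6 §3 Prop. 6.15 (p. 124).
* [Oort1971] F. Oort, *Finite group schemes, local moduli for abelian varieties, and lifting problems*, Compositio Math. 23 (1971): §2.3,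
  Lemma 2.3.3.
* [MumfordAV1970] D. Mumford, *Abelian Varieties* (1970): §13, proof of the Theorem (pp. 125–130) (`Ȟ¹ ⊗ Ȟ¹ ↠ Ȟ²`).
-/

set_option autoImplicit false
set_option linter.dupNamespace false

noncomputable section

namespace Summit.HodgeConjecture.HodgeConjecture.Cruxes.HDel.F11StubG2LineBundleLift

open CategoryTheory CategoryTheory.Limits AlgebraicGeometry IsLocalRing
open Literature.AlgebraicGeometry.AbelianSchemes Literature.AlgebraicGeometry.Modules Literature.AlgebraicGeometry.Motives

/-- **STUB G2 of line `F11LiftWithLineBundle`, proved (MONO-G2 by name)** — the body of `stub_lineBundleLiftOfSomeLift` binder for binder: for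
`A` Artinian local over `ℚ` with a coefficient field `k`, a principal small extension `A ↠ A⧸(t)` (`t ≠ 0`, `t ∈ 𝔪_A`, `𝔪_A·(t) = 0`), an
abelian scheme `A₀` of relative dimension `g` over `Spec (A⧸(t))` with a dual pair `D₀`, a polarisation `pol₀` with graph `Gr₀`, and SOME
abelian lift `X₁` of `A₀` (base-change square `G₁`), there are an abelian lift `X` of relative dimension `g`, a base-change square
`G : A₀ → X`, and a rank-one `L` on `X`, rigidified along the unit section, with `G^*L ≅ Gr₀^*𝒫₀`.  One line over ★
`AbelianSchemeOver.exists_lineBundleLift_of_lift` (the MONO-G2 composition, B-p13 (g22)).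
[cite: MumfordFogartyKirwan1994, App. 7A (pp. 234–235)] [cite: Oort1971, §2.3 Lemma 2.3.3]
[cite: MumfordAV1970, §13, proof of the Theorem (pp. 125–130)] -/
theorem stubG2_holds (g : ℕ) :
    ∀ (A : Type) [CommRing A] [Algebra ℚ A] [IsArtinianRing A] [IsLocalRing A]
      (k : Type) [Field k] [Algebra k A], Function.Surjective (⇑(IsLocalRing.residue A) ∘ ⇑(algebraMap k A)) →
      ∀ (t : A), t ≠ 0 → t ∈ maximalIdeal A → maximalIdeal A * Ideal.span {t} = ⊥ →
      ∀ (A₀ : AbelianSchemeOver (Spec (.of (A ⧸ Ideal.span {t})))) (_ : A₀.IsOfRelDim g) (D₀ : A₀.DualPair) (pol₀ : A₀.Polarization D₀)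
        (Gr₀ : A₀.X.left ⟶ A₀.prodLeft D₀.hat) (_ : Gr₀ ≫ pullback.fst A₀.X.hom D₀.hat.X.hom = 𝟙 _)
        (_ : Gr₀ ≫ pullback.snd A₀.X.hom D₀.hat.X.hom = pol₀.lam.left)
        (X₁ : AbelianSchemeOver (Spec (.of A))) (G₁ : A₀.X.left ⟶ X₁.X.left),
        A₀.IsBaseChangeVia X₁ (Spec.map (CommRingCat.ofHom (Ideal.Quotient.mk (Ideal.span {t})))) G₁ →
        ∃ (X : AbelianSchemeOver (Spec (.of A))) (_ : X.IsOfRelDim g) (G : A₀.X.left ⟶ X.X.left)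
          (_ : A₀.IsBaseChangeVia X (Spec.map (CommRingCat.ofHom (Ideal.Quotient.mk (Ideal.span {t})))) G)
          (L : X.left.Modules) (hL : HasRank L 1)
          (_ : CechPic.pullback X.unitSection (detClass (HasRank.isFiniteLocallyFree' hL)) = 1),
          Nonempty ((Scheme.Modules.pullback G).obj L ≅ (Scheme.Modules.pullback Gr₀).obj D₀.P) :=
  Literature.AlgebraicGeometry.AbelianSchemes.AbelianSchemeOver.exists_lineBundleLift_of_lift g

end Summit.HodgeConjecture.HodgeConjecture.Cruxes.HDel.F11StubG2LineBundleLift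

end
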